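import Summits.QuantumFields.YangMills.Theorems.BalabanUVNodesN21SelectedTopCut13CoPHDefs
import Summits.QuantumFields.YangMills.Theorems.BalabanUVNodesN21ShellSplitSelected13CoPH
import Literature.MathematicalPhysics.QuantumFieldTheory.Balaban1983to89.Node00.Record12MeasurabilityAbsolute

/-!
# N21 (NE7c) · THE SELECTED TOP CUT ON THE THRESHOLD-LETTER ROAD: the top-lettered terms re-sum to the run's partition sum FOR EVERY LETTER (an RT-image of the
# record's level-`k` density — def-T's unity at letters), the PIGEONHOLE UNDER AN RT-ENVELOPE, hence (M1)-FREE: along the grid `θ_i = ε_K(1−ρ)^i` the top-lettered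
# shells ADJACENT TO THEIR OWN CUTS weigh, summed over the depths `i ≤ n`, at most `(2L^m)⁴ ×` the partition sum — so SOME depth (a common one for two runs) carries a
# shell of relative weight `≤ 2(2L^m)⁴∕(n+1)`; NO anti-concentration, NO estimate of Bałaban's

R134 seat `pub-ymgap-dag-n21-d` (g10), node N21 = NE7c (NOT PRINTED; NOT proved at print's fixed thresholds), strategy s2; lane K3⁷ `SpineGivenEndpointR13SepCoPH`
(stmt-QuantumFields-20544, `--supports … --as helper`; COUNT-NEUTRAL).  Imports the definition lane `…N21SelectedTopCut13CoPHDefs` (`topLetter`, `wTopAt`, `topSlotAt`,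
`topClassWeightAt`, `topBandWeightAt`), this seat's generic file `…N21ShellSplitSelected13CoPH` (p60xxxx: `sum_cubeBand_le_one`, `bandFactor_le_sum_cubeBand`, `geom_dichotomy`,
`argmin_badness_bounds`; g9's `measurable_cubeChiAt`, `cubeChiAt_nonneg ∕ _le_one`, `card_cubeIndices_top_le` through it) and K0c's `Node00/Record12MeasurabilityAbsolute`
(the ABSOLUTE (H-U) `localBgMeasurable`).  def-T FILE 19 BY NAME: `wOfRecordAt_apply`, `aWeightAt_nonneg`, `bWeightAt_nonneg`, `abs_wOfRecordAt_le_one`,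
`isStepUnity_wOfRecordAt`, `measurable_wOfRecordAt_of_localBg`, `isRT_tstepOfRecordAt`, `integrable_tstepOfRecordAt`, `tstepOfRecordAt_apply`; def-T FILE 1
`transportOfRecord_nonneg`.  [III] = [Balaban1988Convergent], [LF-I] = [Balaban1989LargeFieldI].

WHAT THIS FILE PROVES (theorems only; 0 `def`, 0 `sorry`; NODE 00's generality `ϑ D g₀ os p g k`, top level `k + 1 = p.K`).
* §17 THE TOP-LETTERED TERMS ARE A (2.18) REPRESENTATION: `wTopAt_nonneg` (`0 ≤ ζ`), `abs_wTopAt_le_one` (`Σ|ζ| ≤ 1`), `measurable_wTopAt` ((H-ζ); (H-U) absolute),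
  `isStepUnity_wTopAt` (`Σζ = 1`), `topSlotAt_nonneg`, `integrable_topSlotAt`, ★★ `isRT_topAssembled` — FOR EVERY LETTER `θ` the assembled top-lettered density
  `Σ_{s′} χ_K^{θ}(s′)·topSlot^{θ}(s′)` is an `IsRT`-image along the averaging of record of the record's level-`k` density `Σ_s χ_k(s)·slot_k(s)` (def-T's
  `isRT_tstepOfRecordAt` at `topLetter ν θ`), ★ `sum_topClassWeightAt_eq` — hence the top-lettered class weights re-sum to the record's level-`k` partition sum (E1-step,
  `f ≡ 1`): the re-lettered top is a legitimate expansion of the SAME partition function; (R) `topBandWeightAt_nonneg ∕ _le_topClassWeight`.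
* §18 ★★ THE PIGEONHOLE UNDER AN RT-ENVELOPE, GENERIC: `sum_range_sum_band_le_card_mul_of_isRT` — depth-indexed nonneg slot families `W_i` on level `k+1` whose assembled
  densities `Σ_{s′} χ^{θ_i}(s′)W_i(s′)` are ALL `IsRT`-images of ONE nonneg integrable level-`k` density `old`: `Σ_{i<m} Σ_{s′} ∫ χ^{θ_i}(s′)(1 − χ^{θ_{i+1}}(s′))W_i(s′) ≤
  #(top cubes)·∫ old` (cover §9 + disjointness §8 of the generic file, tested against `old` through the RT identity with the bounded test function `Σ_a χ_a^{θ_i}(1 − χ_a^{θ_{i+1}})`).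
* §19 ★★★ AT THE TOP-LETTERED TERMS: `sum_range_sum_topBand_le` — for `ρ ≤ 1`, `Σ_{i<m} Σ_{s′} topBand_{s′}(θ_i, θ_{i+1}) ≤ (2L^m)⁴ · Σ_s classWeight_k(s)` (g9's COUNT);
  ★★★ `exists_depth_topBand_le` (one run: SOME depth `i ≤ n` has `Σ_{s′} topBand ≤ ((2L^m)⁴∕(n+1))·Σ_s classWeight_k(s)`) and ★★★ `exists_common_depth_topBand_le` (two runs of
  the same tuple at their own tops, ONE common depth: both `≤ (2(2L^m)⁴∕(n+1)) ×` their partition sums — §10's argmin).  Displayed rows: `0 ≤ ζ`, `Σ|ζ| ≤ 1`, `Σζ = 1`,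
  (H-ζ), F3's (e1) integrability AT LEVEL `k` — at a Stage-13 tuple the first three are `Provisos₁₃CoPH` rows and (e1) is a theorem on the live line (g9 FILE 3 §6).

HONEST FRAMING (binding).  [folklore] measure ∕ finite-sum bookkeeping BY NAME over def-T's lettered T-side and F3's dressed family; NO estimate of Bałaban's asserted or
used.  WHAT IT IS: NE7c's single-run shell-weight bound, at the shell ADJACENT to the cut, for the run's (2.18) terms RE-LETTERED AT THE TOP STEP to a letter SELECTED per
`(K, t)` from the grid below print's `ε_K` — (M1)-FREE.  WHAT IT IS NOT: a bound at print's FIXED threshold `ε_K` (there (M1) stands, g9 FILES 2–7); a keyed face at a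
spine READING (n20-d's `crOfRecord₁₃At` pins `ε_K`; a top-lettered reading, its E1∕E2 rows from §17, and the K3 skeleton's `PinnedAtLive` admitting it are LOCATED — plan ∕
n20-d ∕ N19′, whose core must then be cut at the selected letter); the top 𝐑-step is omitted (it preserves the integral and, at the identity selector, multiplies slots by
`{0,1}` ratios).  No `Provisos` inhabitant claimed (K0⁷ open); NE7c NOT PRINTED ∕ NOT proved at print's thresholds; N21 NOT discharged; K3⁷ NOT claimed; counts UNMOVED
(typed 28∕28 · discharged 5∕27); never a count claim.  No `instance`, no `notation`, no `def`.  One finite four-torus programme at fixed `ε` — NOT ℝ⁴, NOT OS, NOT a mass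
gap, NOT the Clay problem.
-/

noncomputable section

open scoped BigOperators
open Finset MeasureTheory

namespace Summit.QuantumFields.YangMills.Theorems.N21ShellSplitOfRecord13CoPH

open Literature.MathematicalPhysics.QuantumFieldTheory.Balaban1983to89
open Literature.MathematicalPhysics.QuantumFieldTheory.Balaban1983to89.T4Continuum
open Literature.MathematicalPhysics.QuantumFieldTheory.Balaban1983to89.Node00
open Summit.QuantumFields.YangMills.BalabanUVNodes.N19MGFRoadLiveSelectorTower (dressedSlotsOfDatum₉_nonneg)
open Summit.QuantumFields.YangMills.BalabanUVNodes.N19MGFFormAtRecord (wOfRecord₉_nonneg)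

/-! ## §17 The top-lettered terms are a (2.18) representation of the run: weights, positivity, integrability, the RT identity, the E1-step -/

section TopFacts

variable (F : T4Family) (N : ℕ) [NeZero N] (ϑ : Stage9Params F N) (D : FiniteEpsData F (SU N)) (g₀ : ℕ → ℝ) (os : List (ULoop F))
  (p : B12.RunParams) (g : ℕ → ℝ) (k : ℕ)

/-- `0 ≤` the top-lettered step weights at `0 ≤ ζ` (`a|_θ, b|_{2δ} ≥ 0`, def-T FILE 19). [bookkeeping] -/
theorem wTopAt_nonneg (hζ0 : ∀ p g k s Pl Ql RS U V', 0 ≤ ϑ.ζ p g k s Pl Ql RS U V') (θ : ℝ) (s' : SeqOfRecord F ϑ.ν ϑ.τ9.M g p.K (k + 1))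
    (U : GaugeField (F.P p.K) k (SU N)) (V' : GaugeField (F.P p.K) (k + 1) (SU N)) : 0 ≤ wTopAt F N ϑ θ p g k s' U V' := by
  unfold wTopAt
  rw [wOfRecordAt_apply]
  unfold resumWeights
  refine Finset.sum_nonneg fun t _ => ?_
  unfold ωOfRecordAt
  exact mul_nonneg (mul_nonneg (aWeightAt_nonneg F N ϑ.ν ϑ.τ9.M p g k _ _ _ _) (bWeightAt_nonneg F N ϑ.ν ϑ.τ9.M p g k _ _ _ _ _ _))
    (hζ0 _ _ _ _ _ _ _ _ _)

/-- `|w^{θ}| ≤ 1` at `Σ |ζ| ≤ 1` (def-T `abs_wOfRecordAt_le_one`). [bookkeeping] -/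
theorem abs_wTopAt_le_one (hζ1 : IsZetaAbsLeOne F N ϑ.ν ϑ.τ9.M ϑ.ζ) (θ : ℝ) (s' : SeqOfRecord F ϑ.ν ϑ.τ9.M g p.K (k + 1))
    (U : GaugeField (F.P p.K) k (SU N)) (V' : GaugeField (F.P p.K) (k + 1) (SU N)) : |wTopAt F N ϑ θ p g k s' U V'| ≤ 1 :=
  abs_wOfRecordAt_le_one F N ϑ.ν ϑ.τ9.M _ _ hζ1 p g k s' U V'

/-- the top-lettered step weights are jointly measurable under (H-ζ) ((H-U) is K0c's absolute `localBgMeasurable`; def-T `measurable_wOfRecordAt_of_localBg`). [bookkeeping] -/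
theorem measurable_wTopAt (hζm : ZetaMeasurable F N ϑ.ζ) (θ : ℝ) (s' : SeqOfRecord F ϑ.ν ϑ.τ9.M g p.K (k + 1)) :
    Measurable (fun z : GaugeField (F.P p.K) (k + 1) (SU N) × GaugeField (F.P p.K) k (SU N) => wTopAt F N ϑ θ p g k s' z.2 z.1) :=
  measurable_wOfRecordAt_of_localBg (localBgMeasurable F N ϑ.ν) ϑ.τ9.M _ _ hζm p g k s'

/-- the unity law of the top-lettered step weights against the front factors AT THE SAME LETTER (def-T `isStepUnity_wOfRecordAt` at `topLetter ν θ`; `Σ ζ = 1`). [bookkeeping] -/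
theorem isStepUnity_wTopAt (hζu : IsZetaUnity F N ϑ.ν ϑ.τ9.M ϑ.ζ) (θ : ℝ) :
    IsStepUnity (avOfRecord F N p.K k).avg (chiSeqOfRecordAt F N ϑ.ν ϑ.τ9.M g p.K k (topLetter ϑ.ν θ p g k))
      (chiSeqOfRecordAt F N ϑ.ν ϑ.τ9.M g p.K (k + 1) (topLetter ϑ.ν θ p g (k + 1))) (wTopAt F N ϑ θ p g k) :=
  isStepUnity_wOfRecordAt F N ϑ.ν ϑ.τ9.M _ _ hζu p g k

/-- ★ `0 ≤` the top-lettered slot (`w^{θ} ≥ 0`, `χ_k ≥ 0`, `slot_k ≥ 0`; the disintegration transport preserves positivity — def-T `transportOfRecord_nonneg`). [bookkeeping] -/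
theorem topSlotAt_nonneg (hζ0 : ∀ p g k s Pl Ql RS U V', 0 ≤ ϑ.ζ p g k s Pl Ql RS U V') (θ t : ℝ) (s' : SeqOfRecord F ϑ.ν ϑ.τ9.M g p.K (k + 1))
    (V : GaugeField (F.P p.K) (k + 1) (SU N)) : 0 ≤ topSlotAt F N ϑ D g₀ os p g k θ t s' V := by
  rw [topSlotAt_apply]
  exact transportOfRecord_nonneg F N p.K k _ (fun U => mul_nonneg (wTopAt_nonneg F N ϑ p g k hζ0 θ s' U V)
    (mul_nonneg (chiSeqOfRecordAt_nonneg F N ϑ.ν ϑ.τ9.M g p.K k _ _ U)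
      (dressedSlotsOfDatum₉_nonneg F N ϑ D g₀ os p g (wOfRecord₉_nonneg ϑ hζ0 p g) t k _ U))) V

/-- below the top the top letter's front factor IS the record's `χ_k` (`k < p.K`). [bookkeeping] -/
theorem chiSeqOfRecordAt_topLetter_of_lt (hk : k < p.K) (θ : ℝ) :
    chiSeqOfRecordAt F N ϑ.ν ϑ.τ9.M g p.K k (topLetter ϑ.ν θ p g k) = chiSeqOfRecord F N ϑ.ν ϑ.τ9.M g p.K k := by
  rw [topLetter_of_ne ϑ.ν θ p g (Nat.ne_of_lt hk), chiSeqOfRecord_eq_at]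

/-- ★ the top-lettered slot is integrable (`k < p.K`; def-T `integrable_tstepOfRecordAt`: (H-ζ), `Σ|ζ| ≤ 1`, F3's (e1) integrability at level `k`). [bookkeeping] -/
theorem integrable_topSlotAt (hk : k < p.K) (hζm : ZetaMeasurable F N ϑ.ζ) (hζ1 : IsZetaAbsLeOne F N ϑ.ν ϑ.τ9.M ϑ.ζ) (θ t : ℝ)
    (hint : ∀ s : SeqOfRecord F ϑ.ν ϑ.τ9.M g p.K k,
      Integrable (fun U => chiSeqOfRecord F N ϑ.ν ϑ.τ9.M g p.K k s U * dressedSlotsOfDatum₉ F N ϑ D g₀ os t p g k s U) (fieldMeasure (F.P p.K) k (SU N)))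
    (s' : SeqOfRecord F ϑ.ν ϑ.τ9.M g p.K (k + 1)) :
    Integrable (topSlotAt F N ϑ D g₀ os p g k θ t s') (fieldMeasure (F.P p.K) (k + 1) (SU N)) := by
  unfold topSlotAt
  refine integrable_tstepOfRecordAt F N ϑ.ν ϑ.τ9.M (topLetter ϑ.ν θ) hk (fun s'' => measurable_wTopAt F N ϑ p g k hζm θ s'')
    (fun s'' U V' => abs_wTopAt_le_one F N ϑ p g k hζ1 θ s'' U V') (fun s => ?_) s'
  rw [chiSeqOfRecordAt_topLetter_of_lt F N ϑ p g k hk]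
  exact hint s

/-- a top-lettered piece `χ_{k+1}^{θ′}(s′)·topSlot^{θ}(s′)` is integrable (bounded measurable front factor). [bookkeeping] -/
theorem integrable_topPiece (hk : k < p.K) (hζm : ZetaMeasurable F N ϑ.ζ) (hζ1 : IsZetaAbsLeOne F N ϑ.ν ϑ.τ9.M ϑ.ζ) (θ θ' t : ℝ)
    (hint : ∀ s : SeqOfRecord F ϑ.ν ϑ.τ9.M g p.K k,
      Integrable (fun U => chiSeqOfRecord F N ϑ.ν ϑ.τ9.M g p.K k s U * dressedSlotsOfDatum₉ F N ϑ D g₀ os t p g k s U) (fieldMeasure (F.P p.K) k (SU N)))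
    (s' : SeqOfRecord F ϑ.ν ϑ.τ9.M g p.K (k + 1)) :
    Integrable (fun V => chiSeqOfRecordAt F N ϑ.ν ϑ.τ9.M g p.K (k + 1) θ' s' V * topSlotAt F N ϑ D g₀ os p g k θ t s' V)
      (fieldMeasure (F.P p.K) (k + 1) (SU N)) :=
  (integrable_topSlotAt F N ϑ D g₀ os p g k hk hζm hζ1 θ t hint s').bdd_mul (c := 1)
    ((measurable_chiSeqOfRecordAt_of_localBg (localBgMeasurable F N ϑ.ν) ϑ.τ9.M g p.K (k + 1) θ' s').aestronglyMeasurable)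
    (ae_of_all _ fun V => by rw [Real.norm_eq_abs]; exact abs_chiSeqOfRecordAt_le_one F N ϑ.ν ϑ.τ9.M g p.K (k + 1) θ' s' V)

/-- ★★ **FOR EVERY LETTER THE ASSEMBLED TOP-LETTERED DENSITY IS AN RT-IMAGE OF THE RECORD's LEVEL-`k` DENSITY** (`k + 1 = p.K`): def-T's `isRT_tstepOfRecordAt` at the
letter `topLetter ν θ` (front factors at the SAME letter as the (3.2) weight — unity `isStepUnity_wOfRecordAt` from `Σζ = 1`), the level-`k` front factor being the
record's.  Displayed: `Σζ = 1`, `Σ|ζ| ≤ 1`, (H-ζ), F3's (e1) integrability at level `k`. [bookkeeping] -/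
theorem isRT_topAssembled (hk : k + 1 = p.K) (hζm : ZetaMeasurable F N ϑ.ζ) (hζ1 : IsZetaAbsLeOne F N ϑ.ν ϑ.τ9.M ϑ.ζ) (hζu : IsZetaUnity F N ϑ.ν ϑ.τ9.M ϑ.ζ)
    (θ t : ℝ)
    (hint : ∀ s : SeqOfRecord F ϑ.ν ϑ.τ9.M g p.K k,
      Integrable (fun U => chiSeqOfRecord F N ϑ.ν ϑ.τ9.M g p.K k s U * dressedSlotsOfDatum₉ F N ϑ D g₀ os t p g k s U) (fieldMeasure (F.P p.K) k (SU N))) :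
    IsRT (avOfRecord F N p.K k).avg
      (fun U => ∑ s, chiSeqOfRecord F N ϑ.ν ϑ.τ9.M g p.K k s U * dressedSlotsOfDatum₉ F N ϑ D g₀ os t p g k s U)
      (fun V => ∑ s', chiSeqOfRecordAt F N ϑ.ν ϑ.τ9.M g p.K (k + 1) θ s' V * topSlotAt F N ϑ D g₀ os p g k θ t s' V) := by
  have hk' : k < p.K := by omega
  have hlow := chiSeqOfRecordAt_topLetter_of_lt F N ϑ p g k hk' θ
  have htop : topLetter ϑ.ν θ p g (k + 1) = θ := by rw [hk]; exact topLetter_top ϑ.ν θ p g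
  have h := isRT_tstepOfRecordAt F N ϑ.ν ϑ.τ9.M (topLetter ϑ.ν θ) (wTopAt F N ϑ θ) p g k hk'
    (dressedSlotsOfDatum₉ F N ϑ D g₀ os t p g k) (fun s => by rw [hlow]; exact hint s)
    (fun s' => measurable_wTopAt F N ϑ p g k hζm θ s') (fun s' U V' => abs_wTopAt_le_one F N ϑ p g k hζ1 θ s' U V')
    (fun s' => measurable_chiSeqOfRecordAt_of_localBg (localBgMeasurable F N ϑ.ν) ϑ.τ9.M g p.K (k + 1) _ s')
    (isStepUnity_wTopAt F N ϑ p g k hζu θ)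
  rw [hlow, htop] at h
  exact h

/-- ★ **E1-STEP FOR THE TOP-LETTERED TERMS**: for EVERY letter `θ` the top-lettered class weights re-sum to the record's level-`k` partition sum
`Σ_{s′} topClassWeight^{θ}_{s′} = Σ_s classWeight_k(s)` (the RT identity tested against `1`) — the re-lettered top is an expansion of the SAME partition function. [bookkeeping] -/
theorem sum_topClassWeightAt_eq (hk : k + 1 = p.K) (hζm : ZetaMeasurable F N ϑ.ζ) (hζ1 : IsZetaAbsLeOne F N ϑ.ν ϑ.τ9.M ϑ.ζ)
    (hζu : IsZetaUnity F N ϑ.ν ϑ.τ9.M ϑ.ζ) (θ t : ℝ)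
    (hint : ∀ s : SeqOfRecord F ϑ.ν ϑ.τ9.M g p.K k,
      Integrable (fun U => chiSeqOfRecord F N ϑ.ν ϑ.τ9.M g p.K k s U * dressedSlotsOfDatum₉ F N ϑ D g₀ os t p g k s U) (fieldMeasure (F.P p.K) k (SU N))) :
    ∑ s', topClassWeightAt F N ϑ D g₀ os p g k θ t s' = ∑ s, classWeightOfDatum₉ F N ϑ D g₀ os p g k t s := by
  have hk' : k < p.K := by omega
  have h := isRT_topAssembled F N ϑ D g₀ os p g k hk hζm hζ1 hζu θ t hint (fun _ => 1) measurable_const ⟨1, fun _ => by simp⟩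
  simp only [mul_one] at h
  unfold topClassWeightAt classWeightOfDatum₉
  rw [← integral_finsetSum _ fun s' _ => integrable_topPiece F N ϑ D g₀ os p g k hk' hζm hζ1 θ θ t hint s',
    ← integral_finsetSum _ fun s _ => hint s]
  exact h

/-- (R) `0 ≤` the top-lettered band. [bookkeeping] -/
theorem topBandWeightAt_nonneg (hζ0 : ∀ p g k s Pl Ql RS U V', 0 ≤ ϑ.ζ p g k s Pl Ql RS U V') (θ θ' t : ℝ)
    (s' : SeqOfRecord F ϑ.ν ϑ.τ9.M g p.K (k + 1)) : 0 ≤ topBandWeightAt F N ϑ D g₀ os p g k θ θ' t s' :=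
  integral_nonneg fun V => mul_nonneg (bandFactor_nonneg F N ϑ p g (k + 1) θ θ' s' V) (topSlotAt_nonneg F N ϑ D g₀ os p g k hζ0 θ t s' V)

/-- (R) the top-lettered band never exceeds the top-lettered class weight (band factor `≤ χ^{θ}`). [bookkeeping] -/
theorem topBandWeightAt_le_topClassWeight (hk : k < p.K) (hζ0 : ∀ p g k s Pl Ql RS U V', 0 ≤ ϑ.ζ p g k s Pl Ql RS U V') (hζm : ZetaMeasurable F N ϑ.ζ)
    (hζ1 : IsZetaAbsLeOne F N ϑ.ν ϑ.τ9.M ϑ.ζ) (θ θ' t : ℝ)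
    (hint : ∀ s : SeqOfRecord F ϑ.ν ϑ.τ9.M g p.K k,
      Integrable (fun U => chiSeqOfRecord F N ϑ.ν ϑ.τ9.M g p.K k s U * dressedSlotsOfDatum₉ F N ϑ D g₀ os t p g k s U) (fieldMeasure (F.P p.K) k (SU N)))
    (s' : SeqOfRecord F ϑ.ν ϑ.τ9.M g p.K (k + 1)) :
    topBandWeightAt F N ϑ D g₀ os p g k θ θ' t s' ≤ topClassWeightAt F N ϑ D g₀ os p g k θ t s' := by
  unfold topBandWeightAt topClassWeightAt
  refine integral_mono_of_nonneg (ae_of_all _ fun V => mul_nonneg (bandFactor_nonneg F N ϑ p g (k + 1) θ θ' s' V)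
    (topSlotAt_nonneg F N ϑ D g₀ os p g k hζ0 θ t s' V)) (integrable_topPiece F N ϑ D g₀ os p g k hk hζm hζ1 θ θ t hint s') (ae_of_all _ fun V => ?_)
  have h0 := chiSeqOfRecordAt_nonneg F N ϑ.ν ϑ.τ9.M g p.K (k + 1) θ s' V
  have h0' := chiSeqOfRecordAt_nonneg F N ϑ.ν ϑ.τ9.M g p.K (k + 1) θ' s' V
  have hs := topSlotAt_nonneg F N ϑ D g₀ os p g k hζ0 θ t s' V
  have h1 : chiSeqOfRecordAt F N ϑ.ν ϑ.τ9.M g p.K (k + 1) θ s' V * (1 - chiSeqOfRecordAt F N ϑ.ν ϑ.τ9.M g p.K (k + 1) θ' s' V) ≤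
      chiSeqOfRecordAt F N ϑ.ν ϑ.τ9.M g p.K (k + 1) θ s' V := by nlinarith
  exact mul_le_mul_of_nonneg_right h1 hs

end TopFacts

/-! ## §18 The pigeonhole under an RT-envelope, GENERIC -/

section RTPigeonhole

variable (F : T4Family) (N : ℕ) [NeZero N] (ϑ : Stage9Params F N) (p : B12.RunParams) (g : ℕ → ℝ) (k : ℕ)

/-- ★★ **THE PIGEONHOLE OVER DEPTHS UNDER AN RT-ENVELOPE.**  Data: an antitone-or-monotone sequence of cut letters `θ_i`; depth-indexed NONNEGATIVE slot families `W_i(s′)`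
on the level-`(k+1)` fields with `χ_{k+1}^{θ_i}(s′)·W_i(s′)` integrable; a measurable averaging `avg`; ONE nonnegative integrable level-`k` density `old` of which EVERY
assembled density `Σ_{s′} χ_{k+1}^{θ_i}(s′)·W_i(s′)` is an `IsRT`-image along `avg`.  THEN `Σ_{i<m} Σ_{s′} ∫ χ^{θ_i}(s′)(1 − χ^{θ_{i+1}}(s′))·W_i(s′) ≤ #(top cubes) · ∫ old`:
per depth the cover (§9) bounds the band by the cube band indicators `B_i = Σ_a χ_a^{θ_i}(1 − χ_a^{θ_{i+1}})` times the assembled density, the RT identity moves `B_i` onto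
`old` as the test function `B_i ∘ avg`, and `Σ_i B_i ≤ #cubes` pointwise (§8). [bookkeeping] -/
theorem sum_range_sum_band_le_card_mul_of_isRT {θ : ℕ → ℝ} (hθ : (∀ i, θ (i + 1) ≤ θ i) ∨ (∀ i, θ i ≤ θ (i + 1))) (m : ℕ)
    {avg : GaugeField (F.P p.K) k (SU N) → GaugeField (F.P p.K) (k + 1) (SU N)} (havg : Measurable avg)
    (old : GaugeField (F.P p.K) k (SU N) → ℝ) (hold0 : ∀ U, 0 ≤ old U) (holdint : Integrable old (fieldMeasure (F.P p.K) k (SU N)))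
    (W : ℕ → SeqOfRecord F ϑ.ν ϑ.τ9.M g p.K (k + 1) → GaugeField (F.P p.K) (k + 1) (SU N) → ℝ) (hW0 : ∀ i s V, 0 ≤ W i s V)
    (hWint : ∀ i s, Integrable (fun V => chiSeqOfRecordAt F N ϑ.ν ϑ.τ9.M g p.K (k + 1) (θ i) s V * W i s V) (fieldMeasure (F.P p.K) (k + 1) (SU N)))
    (hRT : ∀ i, IsRT avg old (fun V => ∑ s, chiSeqOfRecordAt F N ϑ.ν ϑ.τ9.M g p.K (k + 1) (θ i) s V * W i s V)) :
    ∑ i ∈ Finset.range m, ∑ s, ∫ V, chiSeqOfRecordAt F N ϑ.ν ϑ.τ9.M g p.K (k + 1) (θ i) s V *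
        (1 - chiSeqOfRecordAt F N ϑ.ν ϑ.τ9.M g p.K (k + 1) (θ (i + 1)) s V) * W i s V ∂fieldMeasure (F.P p.K) (k + 1) (SU N) ≤
      ((cubeIndices (F.P p.K) (cubeSide (F.P p.K).L ϑ.ν.M₂ (RkOfRecord (F.P p.K).L ϑ.ν.r (g (k + 1))) (k + 1))).card : ℝ) *
        ∫ U, old U ∂fieldMeasure (F.P p.K) k (SU N) := by
  have hU : LocalBgMeasurable F N ϑ.ν := localBgMeasurable F N ϑ.ν
  -- the cube band indicators of depth `i`, their measurability, range
  set B : ℕ → GaugeField (F.P p.K) (k + 1) (SU N) → ℝ :=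
    fun i V => ∑ a, cubeChiAt F N ϑ.ν g p.K (k + 1) (θ i) a V * (1 - cubeChiAt F N ϑ.ν g p.K (k + 1) (θ (i + 1)) a V) with hBdef
  set C : ℝ := ((cubeIndices (F.P p.K) (cubeSide (F.P p.K).L ϑ.ν.M₂ (RkOfRecord (F.P p.K).L ϑ.ν.r (g (k + 1))) (k + 1))).card : ℝ) with hCdef
  have hBm : ∀ i, Measurable (B i) := fun i => Finset.measurable_sum _ fun a _ =>
    (measurable_cubeChiAt F N ϑ.ν g p.K (k + 1) hU _ a).mul (measurable_const.sub (measurable_cubeChiAt F N ϑ.ν g p.K (k + 1) hU _ a))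
  have hB0 : ∀ i V, 0 ≤ B i V := fun i V => Finset.sum_nonneg fun a _ =>
    mul_nonneg (cubeChiAt_nonneg F N ϑ.ν g p.K (k + 1) _ a V) (sub_nonneg.2 (cubeChiAt_le_one F N ϑ.ν g p.K (k + 1) _ a V))
  have hBC : ∀ i V, B i V ≤ C := fun i V => by
    simp only [hBdef, hCdef]
    calc ∑ a, cubeChiAt F N ϑ.ν g p.K (k + 1) (θ i) a V * (1 - cubeChiAt F N ϑ.ν g p.K (k + 1) (θ (i + 1)) a V)
        ≤ ∑ _a : ↥(cubeIndices (F.P p.K) (cubeSide (F.P p.K).L ϑ.ν.M₂ (RkOfRecord (F.P p.K).L ϑ.ν.r (g (k + 1))) (k + 1))), (1 : ℝ) :=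
          Finset.sum_le_sum fun a _ => by
            have h0 := cubeChiAt_nonneg F N ϑ.ν g p.K (k + 1) (θ (i + 1)) a V
            have h1 := cubeChiAt_le_one F N ϑ.ν g p.K (k + 1) (θ i) a V
            have h0' := cubeChiAt_nonneg F N ϑ.ν g p.K (k + 1) (θ i) a V
            nlinarith
      _ = _ := by rw [Finset.sum_const, nsmul_eq_mul, mul_one, Finset.card_univ, Fintype.card_coe]
  have hBabs : ∀ i V, |B i V| ≤ C := fun i V => by rw [abs_of_nonneg (hB0 i V)]; exact hBC i V
  have hsumB : ∀ V, ∑ i ∈ Finset.range m, B i V ≤ C := fun V => by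
    simp only [hBdef, hCdef]
    rw [Finset.sum_comm]
    calc ∑ a, ∑ i ∈ Finset.range m, cubeChiAt F N ϑ.ν g p.K (k + 1) (θ i) a V * (1 - cubeChiAt F N ϑ.ν g p.K (k + 1) (θ (i + 1)) a V)
        ≤ ∑ _a : ↥(cubeIndices (F.P p.K) (cubeSide (F.P p.K).L ϑ.ν.M₂ (RkOfRecord (F.P p.K).L ϑ.ν.r (g (k + 1))) (k + 1))), (1 : ℝ) :=
          Finset.sum_le_sum fun a _ => sum_cubeBand_le_one F N ϑ.ν g p.K (k + 1) hθ m a V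
      _ = _ := by rw [Finset.sum_const, nsmul_eq_mul, mul_one, Finset.card_univ, Fintype.card_coe]
  -- integrability of the band integrands and of the test products
  have hband : ∀ i s, Integrable (fun V => chiSeqOfRecordAt F N ϑ.ν ϑ.τ9.M g p.K (k + 1) (θ i) s V *
      (1 - chiSeqOfRecordAt F N ϑ.ν ϑ.τ9.M g p.K (k + 1) (θ (i + 1)) s V) * W i s V) (fieldMeasure (F.P p.K) (k + 1) (SU N)) := by
    intro i s
    have h := (hWint i s).bdd_mul (c := 1)
      (((measurable_chiSeqOfRecordAt_of_localBg hU ϑ.τ9.M g p.K (k + 1) (θ (i + 1)) s).const_sub (1 : ℝ)).aestronglyMeasurable)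
      (ae_of_all _ fun V => by
        have h0 := chiSeqOfRecordAt_nonneg F N ϑ.ν ϑ.τ9.M g p.K (k + 1) (θ (i + 1)) s V
        have h1 := chiSeqOfRecordAt_le_one F N ϑ.ν ϑ.τ9.M g p.K (k + 1) (θ (i + 1)) s V
        rw [Real.norm_eq_abs, abs_le]
        constructor <;> linarith)
    refine h.congr (ae_of_all _ fun V => ?_)
    simp only
    ring
  have htest : ∀ i, Integrable (fun V => B i V * ∑ s, chiSeqOfRecordAt F N ϑ.ν ϑ.τ9.M g p.K (k + 1) (θ i) s V * W i s V)
      (fieldMeasure (F.P p.K) (k + 1) (SU N)) := fun i =>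
    (integrable_finsetSum _ fun s _ => hWint i s).bdd_mul (c := C) (hBm i).aestronglyMeasurable
      (ae_of_all _ fun V => by rw [Real.norm_eq_abs]; exact hBabs i V)
  have holdB : ∀ i, Integrable (fun U => old U * B i (avg U)) (fieldMeasure (F.P p.K) k (SU N)) := fun i =>
    holdint.mul_bdd (c := C) ((hBm i).comp havg).aestronglyMeasurable (ae_of_all _ fun U => by rw [Real.norm_eq_abs]; exact hBabs i (avg U))
  -- per depth: cover, then the RT identity
  have hdepth : ∀ i, ∑ s, ∫ V, chiSeqOfRecordAt F N ϑ.ν ϑ.τ9.M g p.K (k + 1) (θ i) s V *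
      (1 - chiSeqOfRecordAt F N ϑ.ν ϑ.τ9.M g p.K (k + 1) (θ (i + 1)) s V) * W i s V ∂fieldMeasure (F.P p.K) (k + 1) (SU N) ≤
      ∫ U, old U * B i (avg U) ∂fieldMeasure (F.P p.K) k (SU N) := by
    intro i
    rw [← integral_finsetSum _ fun s _ => hband i s]
    have hRTi := hRT i (B i) (hBm i) ⟨C, hBabs i⟩
    calc ∫ V, ∑ s, chiSeqOfRecordAt F N ϑ.ν ϑ.τ9.M g p.K (k + 1) (θ i) s V *
          (1 - chiSeqOfRecordAt F N ϑ.ν ϑ.τ9.M g p.K (k + 1) (θ (i + 1)) s V) * W i s V ∂fieldMeasure (F.P p.K) (k + 1) (SU N)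
        ≤ ∫ V, (∑ s, chiSeqOfRecordAt F N ϑ.ν ϑ.τ9.M g p.K (k + 1) (θ i) s V * W i s V) * B i V ∂fieldMeasure (F.P p.K) (k + 1) (SU N) := by
          refine integral_mono (integrable_finsetSum _ fun s _ => hband i s) ((htest i).congr (ae_of_all _ fun V => mul_comm _ _)) fun V => ?_
          -- pointwise cover: `χ(1−χ′)W = (χ(1−χ′))(χW) ≤ B·(χW)` termwise
          show ∑ s, _ ≤ (∑ s, _) * B i V
          rw [Finset.sum_mul]
          refine Finset.sum_le_sum fun s _ => ?_
          have hχW : 0 ≤ chiSeqOfRecordAt F N ϑ.ν ϑ.τ9.M g p.K (k + 1) (θ i) s V * W i s V :=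
            mul_nonneg (chiSeqOfRecordAt_nonneg F N ϑ.ν ϑ.τ9.M g p.K (k + 1) _ s V) (hW0 i s V)
          have hsq : chiSeqOfRecordAt F N ϑ.ν ϑ.τ9.M g p.K (k + 1) (θ i) s V * chiSeqOfRecordAt F N ϑ.ν ϑ.τ9.M g p.K (k + 1) (θ i) s V =
              chiSeqOfRecordAt F N ϑ.ν ϑ.τ9.M g p.K (k + 1) (θ i) s V := by
            rcases chiSeqOfRecordAt_eq_zero_or_one F N ϑ p g (k + 1) (θ i) s V with h | h <;> rw [h] <;> norm_num
          calc chiSeqOfRecordAt F N ϑ.ν ϑ.τ9.M g p.K (k + 1) (θ i) s V * (1 - chiSeqOfRecordAt F N ϑ.ν ϑ.τ9.M g p.K (k + 1) (θ (i + 1)) s V) * W i s V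
              = (chiSeqOfRecordAt F N ϑ.ν ϑ.τ9.M g p.K (k + 1) (θ i) s V * (1 - chiSeqOfRecordAt F N ϑ.ν ϑ.τ9.M g p.K (k + 1) (θ (i + 1)) s V)) *
                  (chiSeqOfRecordAt F N ϑ.ν ϑ.τ9.M g p.K (k + 1) (θ i) s V * W i s V) := by
                conv_lhs => rw [← hsq]
                ring
            _ ≤ B i V * (chiSeqOfRecordAt F N ϑ.ν ϑ.τ9.M g p.K (k + 1) (θ i) s V * W i s V) :=
                mul_le_mul_of_nonneg_right (bandFactor_le_sum_cubeBand F N ϑ p g (k + 1) (θ i) (θ (i + 1)) s V) hχW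
            _ = chiSeqOfRecordAt F N ϑ.ν ϑ.τ9.M g p.K (k + 1) (θ i) s V * W i s V * B i V := mul_comm _ _
      _ = ∫ U, old U * B i (avg U) ∂fieldMeasure (F.P p.K) k (SU N) := hRTi
  -- sum over depths and use `Σ_i B_i ≤ #cubes` against `old ≥ 0`
  calc ∑ i ∈ Finset.range m, ∑ s, ∫ V, chiSeqOfRecordAt F N ϑ.ν ϑ.τ9.M g p.K (k + 1) (θ i) s V *
        (1 - chiSeqOfRecordAt F N ϑ.ν ϑ.τ9.M g p.K (k + 1) (θ (i + 1)) s V) * W i s V ∂fieldMeasure (F.P p.K) (k + 1) (SU N)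
      ≤ ∑ i ∈ Finset.range m, ∫ U, old U * B i (avg U) ∂fieldMeasure (F.P p.K) k (SU N) := Finset.sum_le_sum fun i _ => hdepth i
    _ = ∫ U, old U * ∑ i ∈ Finset.range m, B i (avg U) ∂fieldMeasure (F.P p.K) k (SU N) := by
        rw [← integral_finsetSum _ fun i _ => holdB i]
        refine integral_congr_ae (ae_of_all _ fun U => ?_)
        simp only [Finset.mul_sum]
    _ ≤ ∫ U, old U * C ∂fieldMeasure (F.P p.K) k (SU N) := by
        refine integral_mono_of_nonneg (ae_of_all _ fun U => mul_nonneg (hold0 U) (Finset.sum_nonneg fun i _ => hB0 i (avg U)))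
          (holdint.mul_const C) (ae_of_all _ fun U => mul_le_mul_of_nonneg_left (hsumB (avg U)) (hold0 U))
    _ = C * ∫ U, old U ∂fieldMeasure (F.P p.K) k (SU N) := by rw [integral_mul_const, mul_comm]

end RTPigeonhole

/-! ## §19 At the top-lettered terms: the pigeonhole with g9's COUNT, and the selected depths — (M1)-free -/

section TopPigeonhole

variable (F : T4Family) (N : ℕ) [NeZero N] (ϑ : Stage9Params F N) (D : FiniteEpsData F (SU N)) (g₀ : ℕ → ℝ) (os : List (ULoop F))

/-- ★★★ **THE PIGEONHOLE AT THE TOP-LETTERED TERMS WITH g9's COUNT**: along the grid `θ_i = ε_{k+1}(1 − ρ)^i` (`ρ ≤ 1`; NO sign hypothesis on `ε`), at the run's top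
`k + 1 = p.K`, under `0 ≤ ζ`, `Σ|ζ| ≤ 1`, `Σζ = 1`, (H-ζ) and F3's (e1) integrability at level `k`:
`Σ_{i<m} Σ_{s′} topBand_{s′}(θ_i, θ_{i+1}) ≤ (2L^m)⁴ · Σ_s classWeight_k(s)` — §18 with `W_i := topSlot^{θ_i}`, `old :=` the record's level-`k` density, §17's RT identity,
and `#(top cubes) ≤ (2L^m)⁴` (g9 `card_cubeIndices_top_le`).  NO anti-concentration, NO estimate of Bałaban's. [bookkeeping] -/
theorem sum_range_sum_topBand_le (p : B12.RunParams) (g : ℕ → ℝ) (k : ℕ) (hk : k + 1 = p.K)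
    (hζ0 : ∀ p g k s Pl Ql RS U V', 0 ≤ ϑ.ζ p g k s Pl Ql RS U V') (hζm : ZetaMeasurable F N ϑ.ζ) (hζ1 : IsZetaAbsLeOne F N ϑ.ν ϑ.τ9.M ϑ.ζ)
    (hζu : IsZetaUnity F N ϑ.ν ϑ.τ9.M ϑ.ζ) {ρ : ℝ} (hρ : ρ ≤ 1) (m : ℕ) (t : ℝ)
    (hint : ∀ s : SeqOfRecord F ϑ.ν ϑ.τ9.M g p.K k,
      Integrable (fun U => chiSeqOfRecord F N ϑ.ν ϑ.τ9.M g p.K k s U * dressedSlotsOfDatum₉ F N ϑ D g₀ os t p g k s U) (fieldMeasure (F.P p.K) k (SU N))) :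
    ∑ i ∈ Finset.range m, ∑ s', topBandWeightAt F N ϑ D g₀ os p g k (cutGrid ϑ.ν g (k + 1) ρ i) (cutGrid ϑ.ν g (k + 1) ρ (i + 1)) t s' ≤
      (2 * (F.L : ℝ) ^ F.m) ^ 4 * ∑ s, classWeightOfDatum₉ F N ϑ D g₀ os p g k t s := by
  have hk' : k < p.K := by omega
  have hθ : (∀ i, cutGrid ϑ.ν g (k + 1) ρ (i + 1) ≤ cutGrid ϑ.ν g (k + 1) ρ i) ∨ (∀ i, cutGrid ϑ.ν g (k + 1) ρ i ≤ cutGrid ϑ.ν g (k + 1) ρ (i + 1)) :=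
    geom_dichotomy (epsOfRecord ϑ.ν g (k + 1)) (1 - ρ) (by linarith)
  have hold0 : ∀ U, 0 ≤ ∑ s, chiSeqOfRecord F N ϑ.ν ϑ.τ9.M g p.K k s U * dressedSlotsOfDatum₉ F N ϑ D g₀ os t p g k s U := fun U =>
    Finset.sum_nonneg fun s _ => mul_nonneg (chiSeqOfRecord_nonneg F N ϑ.ν ϑ.τ9.M g p.K k s U)
      (dressedSlotsOfDatum₉_nonneg F N ϑ D g₀ os p g (wOfRecord₉_nonneg ϑ hζ0 p g) t k s U)
  have h18 := sum_range_sum_band_le_card_mul_of_isRT F N ϑ p g k hθ m (avOfRecord_measurable F N p.K k) _ hold0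
    (integrable_finsetSum _ fun s _ => hint s) (fun i s' V => topSlotAt F N ϑ D g₀ os p g k (cutGrid ϑ.ν g (k + 1) ρ i) t s' V)
    (fun i s' V => topSlotAt_nonneg F N ϑ D g₀ os p g k hζ0 _ t s' V)
    (fun i s' => integrable_topPiece F N ϑ D g₀ os p g k hk' hζm hζ1 _ _ t hint s')
    (fun i => isRT_topAssembled F N ϑ D g₀ os p g k hk hζm hζ1 hζu _ t hint)
  have hrhs : ∫ U, ∑ s, chiSeqOfRecord F N ϑ.ν ϑ.τ9.M g p.K k s U * dressedSlotsOfDatum₉ F N ϑ D g₀ os t p g k s U ∂fieldMeasure (F.P p.K) k (SU N) =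
      ∑ s, classWeightOfDatum₉ F N ϑ D g₀ os p g k t s := by
    rw [integral_finsetSum _ fun s _ => hint s]
    rfl
  unfold topBandWeightAt
  refine h18.trans ?_
  rw [hrhs]
  refine mul_le_mul_of_nonneg_right ?_ (Finset.sum_nonneg fun s _ => integral_nonneg fun U =>
    mul_nonneg (chiSeqOfRecord_nonneg F N ϑ.ν ϑ.τ9.M g p.K k s U) (dressedSlotsOfDatum₉_nonneg F N ϑ D g₀ os p g (wOfRecord₉_nonneg ϑ hζ0 p g) t k s U))
  rw [hk]
  exact card_cubeIndices_top_le F p.K _ _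

/-- ★★★ **ONE RUN: SOME DEPTH CARRIES A LIGHT TOP-LETTERED SHELL** — for every `n`, some `i ≤ n` has `Σ_{s′} topBand(θ_i, θ_{i+1}) ≤ ((2L^m)⁴∕(n+1)) · Σ_s classWeight_k(s)`
(the minimum is below the mean).  By §17's E1-step the right side is `((2L^m)⁴∕(n+1)) ×` the top-lettered partition sum AT THAT LETTER: NE7c's single-run shell bound at
the selected cut, (M1)-FREE. [bookkeeping] -/
theorem exists_depth_topBand_le (p : B12.RunParams) (g : ℕ → ℝ) (k : ℕ) (hk : k + 1 = p.K)
    (hζ0 : ∀ p g k s Pl Ql RS U V', 0 ≤ ϑ.ζ p g k s Pl Ql RS U V') (hζm : ZetaMeasurable F N ϑ.ζ) (hζ1 : IsZetaAbsLeOne F N ϑ.ν ϑ.τ9.M ϑ.ζ)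
    (hζu : IsZetaUnity F N ϑ.ν ϑ.τ9.M ϑ.ζ) {ρ : ℝ} (hρ : ρ ≤ 1) (n : ℕ) (t : ℝ)
    (hint : ∀ s : SeqOfRecord F ϑ.ν ϑ.τ9.M g p.K k,
      Integrable (fun U => chiSeqOfRecord F N ϑ.ν ϑ.τ9.M g p.K k s U * dressedSlotsOfDatum₉ F N ϑ D g₀ os t p g k s U) (fieldMeasure (F.P p.K) k (SU N))) :
    ∃ i ∈ Finset.range (n + 1), ∑ s', topBandWeightAt F N ϑ D g₀ os p g k (cutGrid ϑ.ν g (k + 1) ρ i) (cutGrid ϑ.ν g (k + 1) ρ (i + 1)) t s' ≤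
      (2 * (F.L : ℝ) ^ F.m) ^ 4 / (n + 1 : ℕ) * ∑ s, classWeightOfDatum₉ F N ϑ D g₀ os p g k t s := by
  have h := sum_range_sum_topBand_le F N ϑ D g₀ os p g k hk hζ0 hζm hζ1 hζu hρ (n + 1) t hint
  refine Finset.exists_le_of_sum_le ⟨0, Finset.mem_range.2 (Nat.succ_pos n)⟩ (h.trans (le_of_eq ?_))
  rw [Finset.sum_const, Finset.card_range, nsmul_eq_mul]
  have hn : ((n + 1 : ℕ) : ℝ) ≠ 0 := by positivity
  field_simp

/-- ★★★ **TWO RUNS OF THE SAME TUPLE, ONE COMMON DEPTH** (run 1 at its top `k₁ + 1 = p₁.K`, run 2 at `k₂ + 1 = p₂.K`, one width `ρ ≤ 1`, one depth budget `n`, one source `t`):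
some `i ≤ n` has BOTH `Σ_{s′} topBand¹(θ¹_i, θ¹_{i+1}) ≤ (2(2L^m)⁴∕(n+1))·Σ_s classWeight¹_{k₁}(s)` AND the same for run 2 — §10's argmin of the normalised two-run band mass.
This is NE7c for BOTH runs of a comparison at a COMMON relative cut `(1 − ρ)^{i}` below each run's own `ε`, (M1)-FREE. [bookkeeping] -/
theorem exists_common_depth_topBand_le (p₁ : B12.RunParams) (g₁ : ℕ → ℝ) (k₁ : ℕ) (hk₁ : k₁ + 1 = p₁.K) (p₂ : B12.RunParams) (g₂ : ℕ → ℝ) (k₂ : ℕ)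
    (hk₂ : k₂ + 1 = p₂.K)
    (hζ0 : ∀ p g k s Pl Ql RS U V', 0 ≤ ϑ.ζ p g k s Pl Ql RS U V') (hζm : ZetaMeasurable F N ϑ.ζ) (hζ1 : IsZetaAbsLeOne F N ϑ.ν ϑ.τ9.M ϑ.ζ)
    (hζu : IsZetaUnity F N ϑ.ν ϑ.τ9.M ϑ.ζ) {ρ : ℝ} (hρ : ρ ≤ 1) (n : ℕ) (t : ℝ)
    (hint₁ : ∀ s : SeqOfRecord F ϑ.ν ϑ.τ9.M g₁ p₁.K k₁,
      Integrable (fun U => chiSeqOfRecord F N ϑ.ν ϑ.τ9.M g₁ p₁.K k₁ s U * dressedSlotsOfDatum₉ F N ϑ D g₀ os t p₁ g₁ k₁ s U) (fieldMeasure (F.P p₁.K) k₁ (SU N)))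
    (hint₂ : ∀ s : SeqOfRecord F ϑ.ν ϑ.τ9.M g₂ p₂.K k₂,
      Integrable (fun U => chiSeqOfRecord F N ϑ.ν ϑ.τ9.M g₂ p₂.K k₂ s U * dressedSlotsOfDatum₉ F N ϑ D g₀ os t p₂ g₂ k₂ s U) (fieldMeasure (F.P p₂.K) k₂ (SU N))) :
    ∃ i ∈ Finset.range (n + 1),
      ∑ s', topBandWeightAt F N ϑ D g₀ os p₁ g₁ k₁ (cutGrid ϑ.ν g₁ (k₁ + 1) ρ i) (cutGrid ϑ.ν g₁ (k₁ + 1) ρ (i + 1)) t s' ≤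
          2 * (2 * (F.L : ℝ) ^ F.m) ^ 4 / (n + 1 : ℕ) * ∑ s, classWeightOfDatum₉ F N ϑ D g₀ os p₁ g₁ k₁ t s ∧
        ∑ s', topBandWeightAt F N ϑ D g₀ os p₂ g₂ k₂ (cutGrid ϑ.ν g₂ (k₂ + 1) ρ i) (cutGrid ϑ.ν g₂ (k₂ + 1) ρ (i + 1)) t s' ≤
          2 * (2 * (F.L : ℝ) ^ F.m) ^ 4 / (n + 1 : ℕ) * ∑ s, classWeightOfDatum₉ F N ϑ D g₀ os p₂ g₂ k₂ t s := by
  set f : ℕ → ℝ := fun i => ∑ s', topBandWeightAt F N ϑ D g₀ os p₁ g₁ k₁ (cutGrid ϑ.ν g₁ (k₁ + 1) ρ i) (cutGrid ϑ.ν g₁ (k₁ + 1) ρ (i + 1)) t s' with hf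
  set f' : ℕ → ℝ := fun i => ∑ s', topBandWeightAt F N ϑ D g₀ os p₂ g₂ k₂ (cutGrid ϑ.ν g₂ (k₂ + 1) ρ i) (cutGrid ϑ.ν g₂ (k₂ + 1) ρ (i + 1)) t s' with hf'
  set S₁ : ℝ := ∑ s, classWeightOfDatum₉ F N ϑ D g₀ os p₁ g₁ k₁ t s with hS₁
  set S₂ : ℝ := ∑ s, classWeightOfDatum₉ F N ϑ D g₀ os p₂ g₂ k₂ t s with hS₂
  have hf0 : ∀ i, 0 ≤ f i := fun i => Finset.sum_nonneg fun s' _ => topBandWeightAt_nonneg F N ϑ D g₀ os p₁ g₁ k₁ hζ0 _ _ t s'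
  have hf'0 : ∀ i, 0 ≤ f' i := fun i => Finset.sum_nonneg fun s' _ => topBandWeightAt_nonneg F N ϑ D g₀ os p₂ g₂ k₂ hζ0 _ _ t s'
  have hw₁ : ∀ k s' U V', 0 ≤ wOfRecord₉ F N ϑ p₁ g₁ k s' U V' := wOfRecord₉_nonneg ϑ hζ0 p₁ g₁
  have hw₂ : ∀ k s' U V', 0 ≤ wOfRecord₉ F N ϑ p₂ g₂ k s' U V' := wOfRecord₉_nonneg ϑ hζ0 p₂ g₂
  have hS₁0 : 0 ≤ S₁ := Finset.sum_nonneg fun s _ => classWeightOfDatum₉_nonneg' F N ϑ D g₀ os p₁ g₁ k₁ hw₁ t s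
  have hS₂0 : 0 ≤ S₂ := Finset.sum_nonneg fun s _ => classWeightOfDatum₉_nonneg' F N ϑ D g₀ os p₂ g₂ k₂ hw₂ t s
  have hsum₁ : ∑ i ∈ Finset.range (n + 1), f i ≤ (2 * (F.L : ℝ) ^ F.m) ^ 4 * S₁ :=
    sum_range_sum_topBand_le F N ϑ D g₀ os p₁ g₁ k₁ hk₁ hζ0 hζm hζ1 hζu hρ (n + 1) t hint₁
  have hsum₂ : ∑ i ∈ Finset.range (n + 1), f' i ≤ (2 * (F.L : ℝ) ^ F.m) ^ 4 * S₂ :=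
    sum_range_sum_topBand_le F N ϑ D g₀ os p₂ g₂ k₂ hk₂ hζ0 hζm hζ1 hζu hρ (n + 1) t hint₂
  obtain ⟨i₀, hi₀, hmin⟩ := (Finset.range (n + 1)).exists_min_image (fun i => f i / S₁ + f' i / S₂) ⟨0, by simp⟩
  exact ⟨i₀, hi₀, argmin_badness_bounds hf0 hf'0 hS₁0 hS₂0 (by positivity) hsum₁ hsum₂ hi₀ hmin⟩

end TopPigeonhole

end Summit.QuantumFields.YangMills.Theorems.N21ShellSplitOfRecord13CoPH

end
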